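import Mathlib
import Literature.AlgebraicGeometry.HyperbolicPolynomials.HyperbolicityCone
import HarnessLib

/-!
# Gårding's theorem: hyperbolicity cones are convex

Topic `Literature/AlgebraicGeometry/HyperbolicPolynomials`, companion of `HyperbolicityCone.lean`
(which defines `IsHyperbolic f e`, the closed cone `hyperbolicityCone f e = Λ₊` and the open cone
`openHyperbolicityCone f e = Λ₊₊` in root-free form and leaves "Gårding's theorems … to a
companion file"). Everything here is PROVED; no named facts.

## Main results (namespace `Literature.AlgebraicGeometry.HyperbolicPolynomials`), for a form `f`
(`f.IsHomogeneous d`) hyperbolic w.r.t. `e`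

* `IsHyperbolic.of_mem_openHyperbolicityCone` — **Gårding 1959, Thm 2 (first half)**: `f` is
  hyperbolic w.r.t. every `b ∈ Λ₊₊(f, e)`.
* `openHyperbolicityCone_eq_of_mem`, `hyperbolicityCone_eq_of_mem` — **Thm 2 (second half)**:
  `Λ₊₊(f, b) = Λ₊₊(f, e)` and `Λ₊(f, b) = Λ₊(f, e)` for `b ∈ Λ₊₊(f, e)`.
* `convex_openHyperbolicityCone`, `convex_hyperbolicityCone` — **the cones are convex**
  (Gårding 1959, Thm 2; Renegar 2006, Thm 3).
* `IsHyperbolic.isOpen_openHyperbolicityCone`, `hyperbolicityCone_eq_closure`,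
  `interior_hyperbolicityCone` (`interior Λ₊ = Λ₊₊`), `frontier_hyperbolicityCone`
  (`∂Λ₊ = Λ₊ ∩ {f = 0}`) — Renegar 2006, §2.

## Proof (Gårding's, via the location of complex roots)

For `b ∈ Λ₊₊(f,e)` and real `x` consider `τ ↦ f_ℂ(x + ie + τb)` (`gardingPoly`), of degree `d`
with top coefficient `f(b) ≠ 0`. It has no real root (a real root `τ` would make `i` a non-real
zero of `z ↦ f(x + τb + ze)`), at `x = 0` its roots are `-i/λⱼ(b)` with `λⱼ(b) > 0`, and its
coefficients are polynomial in `x`; since roots of a coefficientwise-continuous family of fixed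
degree move continuously (`eventually_roots_near`, `eventually_exists_root_near`, proved here from
the Cauchy bound and the factorisation over `ℂ`), the set of `x` for which all roots lie in the
open lower half-plane is clopen and non-empty in the connected space `ℝ^σ`, hence everything
(`gardingPoly_root_im_neg`). Rescaling, the roots of `τ ↦ f_ℂ(x + ise + τb)` lie in the lower
half-plane for every `s > 0`; letting `s → 0⁺`, every root of `τ ↦ f_ℂ(x + τb)` has `Im ≤ 0`, and
by conjugation symmetry `Im = 0`. The equality of the cones is a connectedness argument inside the
star-shaped set `Λ₊₊(f,e)`; convexity follows (`x + y ∈ Λ₊₊(f, x) = Λ₊₊(f, e)`), and `Λ₊` is the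
closure of `Λ₊₊`.

## References

* [Garding1959] L. Gårding, *An inequality for hyperbolic polynomials*, J. Math. Mech. 8 (1959)
  957–965: §2, Thm 2 (hyperbolicity in every direction of `C`, `C(b) = C(a)`, convexity).
* [Renegar2006] J. Renegar, *Hyperbolic programs, and their derivative relaxations*, Found.
  Comput. Math. 6 (2006) 59–79: §2 (`Λ₊₊` open, `Λ₊` its closure), Thm 3 (convexity).
-/

noncomputable section

open MvPolynomial Filter Topology
open scoped BigOperators Polynomial ComplexConjugate

namespace Literature.AlgebraicGeometry.HyperbolicPolynomials

variable {σ : Type*}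

/-! ### The coefficients of the line polynomial are polynomial in the base point -/

section Coeff

variable {R : Type*} [CommRing R]

/-- The line polynomial with *generic* base point, `f(X + t v) ∈ (R[X_σ])[t]`: its image under
`X ↦ x` is `linePoly f x v` (`map_eval_linePolyGen`). [folklore] -/
def linePolyGen (f : MvPolynomial σ R) (v : σ → R) : (MvPolynomial σ R)[X] :=
  MvPolynomial.aeval
    (fun j => Polynomial.C (C (v j)) * Polynomial.X + Polynomial.C (X j : MvPolynomial σ R)) f

/-- Specialising the generic base point. [folklore] -/
theorem map_eval_linePolyGen (f : MvPolynomial σ R) (x v : σ → R) :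
    (linePolyGen f v).map (MvPolynomial.eval x) = linePoly f x v := by
  have key : (Polynomial.mapRingHom (MvPolynomial.eval x)).comp
      (MvPolynomial.aeval (R := R)
        (fun j => Polynomial.C (C (v j)) * Polynomial.X + Polynomial.C (X j : MvPolynomial σ R))).toRingHom
      = (MvPolynomial.aeval (R := R)
          (fun j => Polynomial.C (v j) * Polynomial.X + Polynomial.C (x j))).toRingHom := by
    refine MvPolynomial.ringHom_ext (fun a => ?_) (fun j => ?_)
    · simp [Polynomial.map_C]
    · simp [Polynomial.map_add, Polynomial.map_mul]
  exact DFunLike.congr_fun key f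

/-- The `k`-th coefficient of `t ↦ f(x + tv)` is a polynomial function of `x`. [folklore] -/
theorem coeff_linePoly_eq_eval_linePolyGen (f : MvPolynomial σ R) (x v : σ → R) (k : ℕ) :
    (linePoly f x v).coeff k = MvPolynomial.eval x ((linePolyGen f v).coeff k) := by
  rw [← map_eval_linePolyGen, Polynomial.coeff_map]

/-- Hence it depends continuously on `x`. [folklore] -/
theorem continuous_coeff_linePoly [TopologicalSpace R] [IsTopologicalRing R] (f : MvPolynomial σ R)
    (v : σ → R) (k : ℕ) : Continuous fun x : σ → R => (linePoly f x v).coeff k := by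
  simp_rw [coeff_linePoly_eq_eval_linePolyGen]
  exact MvPolynomial.continuous_eval _

end Coeff

/-! ### Roots of a coefficientwise convergent family of complex polynomials -/

section Roots

open Polynomial Metric

variable {ι : Type*} {l : Filter ι} {p : ι → ℂ[X]} {q : ℂ[X]} {d : ℕ}

/-- Uniform convergence of the evaluations on bounded sets. [folklore] -/
theorem eventually_norm_eval_sub_lt (hdeg : ∀ i, (p i).natDegree ≤ d) (hqd : q.natDegree ≤ d)
    (hlim : ∀ k, Tendsto (fun i => (p i).coeff k) l (𝓝 (q.coeff k))) (R : ℝ) {m : ℝ}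
    (hm : 0 < m) : ∀ᶠ i in l, ∀ τ : ℂ, ‖τ‖ ≤ R → ‖(p i).eval τ - q.eval τ‖ < m := by
  have hR : ∀ τ : ℂ, ‖τ‖ ≤ R → ∀ i,
      ‖(p i).eval τ - q.eval τ‖ ≤ ∑ k ∈ Finset.range (d + 1), ‖(p i).coeff k - q.coeff k‖ * |R| ^ k := by
    intro τ hτ i
    rw [eval_eq_sum_range' (Nat.lt_succ_of_le (hdeg i)), eval_eq_sum_range' (Nat.lt_succ_of_le hqd),
      ← Finset.sum_sub_distrib]
    refine (norm_sum_le _ _).trans (Finset.sum_le_sum fun k _ => ?_)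
    rw [← sub_mul, norm_mul, norm_pow]
    exact mul_le_mul_of_nonneg_left (pow_le_pow_left₀ (norm_nonneg _) (hτ.trans (le_abs_self R)) k)
      (norm_nonneg _)
  have hsum : Tendsto (fun i => ∑ k ∈ Finset.range (d + 1), ‖(p i).coeff k - q.coeff k‖ * |R| ^ k)
      l (𝓝 0) := by
    rw [show (0 : ℝ) = ∑ k ∈ Finset.range (d + 1), ‖q.coeff k - q.coeff k‖ * |R| ^ k by simp]
    refine tendsto_finsetSum _ fun k _ => ?_
    exact (((hlim k).sub (tendsto_const_nhds (x := q.coeff k))).norm).mul tendsto_const_nhds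
  filter_upwards [(tendsto_order.1 hsum).2 m hm] with i hi τ hτ
  exact (hR τ hτ i).trans_lt hi

/-- Pointwise convergence of the evaluations. [folklore] -/
theorem tendsto_eval_of_tendsto_coeff (hdeg : ∀ i, (p i).natDegree ≤ d) (hqd : q.natDegree ≤ d)
    (hlim : ∀ k, Tendsto (fun i => (p i).coeff k) l (𝓝 (q.coeff k))) (τ : ℂ) :
    Tendsto (fun i => (p i).eval τ) l (𝓝 (q.eval τ)) := by
  rw [eval_eq_sum_range' (Nat.lt_succ_of_le hqd)]
  have : ∀ i, (p i).eval τ = ∑ k ∈ Finset.range (d + 1), (p i).coeff k * τ ^ k := fun i =>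
    eval_eq_sum_range' (Nat.lt_succ_of_le (hdeg i)) τ
  simp_rw [this]
  exact tendsto_finsetSum _ fun k _ => (hlim k).mul tendsto_const_nhds

/-- Eventually the top coefficient is bounded below, the degree is exactly `d`, and all
coefficients are bounded. [folklore] -/
theorem eventually_coeff_control (hdeg : ∀ i, (p i).natDegree ≤ d) (hq : q.coeff d ≠ 0)
    (hlim : ∀ k, Tendsto (fun i => (p i).coeff k) l (𝓝 (q.coeff k))) :
    ∀ᶠ i in l, ‖q.coeff d‖ / 2 ≤ ‖(p i).coeff d‖ ∧ (p i).natDegree = d ∧ p i ≠ 0 ∧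
      ∀ k, ‖(p i).coeff k‖ ≤ ‖q.coeff k‖ + 1 := by
  have hqd : 0 < ‖q.coeff d‖ / 2 := by positivity
  have h1 : ∀ᶠ i in l, ‖q.coeff d‖ / 2 ≤ ‖(p i).coeff d‖ := by
    have := ((hlim d).sub (tendsto_const_nhds (x := q.coeff d))).norm
    rw [sub_self, norm_zero] at this
    filter_upwards [(tendsto_order.1 this).2 _ hqd] with i hi
    have := norm_sub_norm_le (q.coeff d) ((p i).coeff d)
    rw [← norm_neg, neg_sub] at hi
    linarith
  have h2 : ∀ k, ∀ᶠ i in l, ‖(p i).coeff k‖ ≤ ‖q.coeff k‖ + 1 := by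
    intro k
    have := ((hlim k).sub (tendsto_const_nhds (x := q.coeff k))).norm
    rw [sub_self, norm_zero] at this
    filter_upwards [(tendsto_order.1 this).2 1 one_pos] with i hi
    have := norm_sub_norm_le ((p i).coeff k) (q.coeff k)
    linarith
  -- coefficients above `d` vanish, so only finitely many `k` matter
  have h3 : ∀ᶠ i in l, ∀ k : Fin (d + 1), ‖(p i).coeff k‖ ≤ ‖q.coeff k‖ + 1 :=
    eventually_all.2 fun k => h2 k
  filter_upwards [h1, h3] with i hi1 hi3
  have hne : (p i).coeff d ≠ 0 := fun h0 => by
    rw [h0, norm_zero] at hi1; linarith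
  have hdeg' : (p i).natDegree = d := le_antisymm (hdeg i) (le_natDegree_of_ne_zero hne)
  refine ⟨hi1, hdeg', fun h0 => hne (by rw [h0, Polynomial.coeff_zero]), fun k => ?_⟩
  by_cases hk : k ≤ d
  · exact hi3 ⟨k, Nat.lt_succ_of_le hk⟩
  · rw [coeff_eq_zero_of_natDegree_lt (by omega), norm_zero]; positivity

/-- Eventually all roots lie in a fixed ball. [folklore] -/
theorem eventually_roots_norm_le (hdeg : ∀ i, (p i).natDegree ≤ d) (hq : q.coeff d ≠ 0)
    (hlim : ∀ k, Tendsto (fun i => (p i).coeff k) l (𝓝 (q.coeff k))) :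
    ∃ R : ℝ, ∀ᶠ i in l, ∀ τ ∈ (p i).roots, ‖τ‖ ≤ R := by
  classical
  set M : ℝ := (Finset.range (d + 1)).sup' Finset.nonempty_range_add_one fun k => ‖q.coeff k‖ + 1
  have hM : ∀ k ≤ d, ‖q.coeff k‖ + 1 ≤ M := fun k hk =>
    Finset.le_sup' (fun k => ‖q.coeff k‖ + 1) (Finset.mem_range.2 (Nat.lt_succ_of_le hk))
  have hM0 : 0 ≤ M := le_trans (by positivity) (hM 0 (Nat.zero_le d))
  refine ⟨M / (‖q.coeff d‖ / 2) + 1, ?_⟩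
  filter_upwards [eventually_coeff_control hdeg hq hlim] with i hi τ hτ
  obtain ⟨hlc, hdeg', hne, hbd⟩ := hi
  have hroot : (p i).IsRoot τ := (mem_roots hne).1 hτ
  have hlt : ‖τ‖ < (cauchyBound (p i) : ℝ) := by
    have := hroot.norm_lt_cauchyBound hne
    exact_mod_cast this
  refine hlt.le.trans ?_
  -- bound the Cauchy bound
  have hlcpos : 0 < ‖(p i).leadingCoeff‖ := by
    rw [Polynomial.leadingCoeff, hdeg']; exact lt_of_lt_of_le (by positivity) hlc
  have hsup : ((Finset.sup (Finset.range (p i).natDegree) fun k => ‖(p i).coeff k‖₊ : NNReal) : ℝ)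
      ≤ M := by
    have : (Finset.sup (Finset.range (p i).natDegree) fun k => ‖(p i).coeff k‖₊) ≤ ⟨M, hM0⟩ := by
      refine Finset.sup_le fun k hk => ?_
      rw [hdeg', Finset.mem_range] at hk
      change ‖(p i).coeff k‖ ≤ M
      exact (hbd k).trans (hM k hk.le)
    exact_mod_cast this
  have hcb : (cauchyBound (p i) : ℝ) =
      ((Finset.sup (Finset.range (p i).natDegree) fun k => ‖(p i).coeff k‖₊ : NNReal) : ℝ) /
        ‖(p i).leadingCoeff‖ + 1 := by
    simp [cauchyBound]
  rw [hcb]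
  refine add_le_add_left ?_ 1
  rw [div_le_div_iff₀ hlcpos (by positivity)]
  calc ((Finset.sup (Finset.range (p i).natDegree) fun k => ‖(p i).coeff k‖₊ : NNReal) : ℝ) *
        (‖q.coeff d‖ / 2) ≤ M * ‖(p i).leadingCoeff‖ := by
        refine mul_le_mul hsup ?_ (by positivity) hM0
        rw [Polynomial.leadingCoeff, hdeg']; exact hlc
    _ = M * ‖(p i).leadingCoeff‖ := rfl

/-- **Roots of the limit attract the roots** (upper semicontinuity of the root set): eventually every
root of `p i` is within `ε` of a root of `q`. [folklore] -/
theorem eventually_roots_near (hdeg : ∀ i, (p i).natDegree ≤ d) (hqd : q.natDegree ≤ d)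
    (hq : q.coeff d ≠ 0) (hlim : ∀ k, Tendsto (fun i => (p i).coeff k) l (𝓝 (q.coeff k)))
    {ε : ℝ} (hε : 0 < ε) :
    ∀ᶠ i in l, ∀ τ ∈ (p i).roots, ∃ τ₀ ∈ q.roots, ‖τ - τ₀‖ < ε := by
  classical
  have hq0 : q ≠ 0 := fun h0 => hq (by rw [h0, Polynomial.coeff_zero])
  obtain ⟨R, hR⟩ := eventually_roots_norm_le hdeg hq hlim
  -- the compact set where `q` is bounded below
  set K : Set ℂ := closedBall (0 : ℂ) R \ ⋃ τ₀ ∈ q.roots.toFinset, ball τ₀ ε with hK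
  have hKc : IsCompact K :=
    (isCompact_closedBall _ _).diff (isOpen_biUnion fun _ _ => isOpen_ball)
  have hKq : ∀ τ ∈ K, q.eval τ ≠ 0 := by
    intro τ hτ h0
    refine hτ.2 (Set.mem_iUnion₂.2 ⟨τ, Multiset.mem_toFinset.2 ((mem_roots hq0).2 h0), ?_⟩)
    exact mem_ball_self hε
  obtain ⟨m, hm, hmK⟩ : ∃ m : ℝ, 0 < m ∧ ∀ τ ∈ K, m ≤ ‖q.eval τ‖ := by
    by_cases hKn : K.Nonempty
    · obtain ⟨τ₁, hτ₁, hmin⟩ :=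
        hKc.exists_isMinOn hKn (continuous_norm.comp (q.continuous_eval₂ _)).continuousOn
      exact ⟨‖q.eval τ₁‖, norm_pos_iff.2 (hKq τ₁ hτ₁), fun τ hτ => hmin hτ⟩
    · exact ⟨1, one_pos, fun τ hτ => (hKn ⟨τ, hτ⟩).elim⟩
  filter_upwards [hR, eventually_norm_eval_sub_lt hdeg hqd hlim R hm] with i hiR hi τ hτ
  have hroot : (p i).eval τ = 0 := by
    have hne : p i ≠ 0 := fun h0 => by rw [h0, roots_zero] at hτ; exact Multiset.notMem_zero _ hτ
    exact (mem_roots hne).1 hτ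
  have hτK : τ ∉ K := by
    intro hτK
    have h1 := hi τ (hiR τ hτ)
    rw [hroot, zero_sub, norm_neg] at h1
    exact absurd (hmK τ hτK) (not_le.2 h1)
  rw [hK, Set.mem_sdiff, not_and, not_not] at hτK
  obtain ⟨τ₀, hτ₀, hττ₀⟩ := Set.mem_iUnion₂.1 (hτK (mem_closedBall_zero_iff.2 (hiR τ hτ)))
  exact ⟨τ₀, Multiset.mem_toFinset.1 hτ₀, mem_ball_iff_norm.1 hττ₀⟩

/-- **Roots persist**: eventually there is a root of `p i` within `ε` of any given root of `q`.
[folklore] -/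
theorem eventually_exists_root_near (hdeg : ∀ i, (p i).natDegree ≤ d) (hqd : q.natDegree ≤ d)
    (hq : q.coeff d ≠ 0) (hlim : ∀ k, Tendsto (fun i => (p i).coeff k) l (𝓝 (q.coeff k)))
    {τ₀ : ℂ} (hτ₀ : q.IsRoot τ₀) {ε : ℝ} (hε : 0 < ε) :
    ∀ᶠ i in l, ∃ τ ∈ (p i).roots, ‖τ - τ₀‖ < ε := by
  classical
  have hd : 0 < d := by
    rcases Nat.eq_zero_or_pos d with rfl | hd
    · exfalso
      have hq' : q = Polynomial.C (q.coeff 0) := eq_C_of_natDegree_le_zero hqd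
      rw [hq', IsRoot.def, Polynomial.eval_C] at hτ₀
      exact hq hτ₀
    · exact hd
  have hev : Tendsto (fun i => (p i).eval τ₀) l (𝓝 0) := by
    simpa [hτ₀.eq_zero] using tendsto_eval_of_tendsto_coeff hdeg hqd hlim τ₀
  have hpos : 0 < ‖q.coeff d‖ / 2 * ε ^ d := by positivity
  filter_upwards [eventually_coeff_control hdeg hq hlim,
    (tendsto_order.1 (tendsto_norm_zero.comp hev)).2 _ hpos] with i hi hismall
  obtain ⟨hlc, hdeg', hne, -⟩ := hi
  by_contra hfar
  push Not at hfar
  -- factor `p i` over `ℂ`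
  have hfac := C_leadingCoeff_mul_prod_multiset_X_sub_C
    (IsAlgClosed.card_roots_eq_natDegree (p := p i))
  have heval : (p i).eval τ₀ =
      (p i).leadingCoeff * ((p i).roots.map fun r => τ₀ - r).prod := by
    conv_lhs => rw [← hfac]
    rw [Polynomial.eval_mul, Polynomial.eval_C, eval_multiset_prod, Multiset.map_map]
    congr 1
    exact congrArg Multiset.prod (Multiset.map_congr rfl fun r _ => by simp)
  have hnorm : ‖q.coeff d‖ / 2 * ε ^ d ≤ ‖(p i).eval τ₀‖ := by
    rw [heval, norm_mul, show ∀ m : Multiset ℂ, ‖m.prod‖ = (m.map norm).prod from fun m =>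
      map_multiset_prod (normHom : ℂ →*₀ ℝ) m, Multiset.map_map]
    refine mul_le_mul ?_ ?_ (by positivity) (norm_nonneg _)
    · rw [Polynomial.leadingCoeff, hdeg']; exact hlc
    · have hcard : Multiset.card (p i).roots = d := by
        rw [IsAlgClosed.card_roots_eq_natDegree, hdeg']
      calc ε ^ d = ((p i).roots.map fun _ => ε).prod := by
            rw [Multiset.map_const', Multiset.prod_replicate, hcard]
        _ ≤ ((p i).roots.map (Function.comp norm fun r => τ₀ - r)).prod :=
            Multiset.prod_map_le_prod_map₀ _ _ (fun _ _ => hε.le) fun r hr => by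
              simpa [norm_sub_rev] using hfar r hr
  have : ‖(p i).eval τ₀‖ < ‖q.coeff d‖ / 2 * ε ^ d := by simpa using hismall
  linarith

/-- Eventually all roots lie in any open set containing the roots of the limit. [folklore] -/
theorem eventually_roots_subset_of_isOpen (hdeg : ∀ i, (p i).natDegree ≤ d)
    (hqd : q.natDegree ≤ d) (hq : q.coeff d ≠ 0)
    (hlim : ∀ k, Tendsto (fun i => (p i).coeff k) l (𝓝 (q.coeff k))) {U : Set ℂ} (hU : IsOpen U)
    (hroots : ∀ τ₀ ∈ q.roots, τ₀ ∈ U) : ∀ᶠ i in l, ∀ τ ∈ (p i).roots, τ ∈ U := by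
  classical
  obtain ⟨δ, hδ, hsub⟩ := (q.roots.toFinset.finite_toSet.isCompact).exists_cthickening_subset_open
    hU (fun τ₀ hτ₀ => hroots τ₀ (Multiset.mem_toFinset.1 hτ₀))
  filter_upwards [eventually_roots_near hdeg hqd hq hlim hδ] with i hi τ hτ
  obtain ⟨τ₀, hτ₀, hnear⟩ := hi τ hτ
  refine hsub (Metric.mem_cthickening_of_dist_le τ τ₀ δ _ (Multiset.mem_toFinset.2 hτ₀) ?_)
  rw [dist_eq_norm]; exact hnear.le

end Roots

/-! ### Complexification helpers -/

section Complexify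

/-- Evaluation of the complexification at a real vector. [folklore] -/
theorem eval_map_ofReal (f : MvPolynomial σ ℝ) (x : σ → ℝ) :
    MvPolynomial.eval (fun j => (x j : ℂ)) (MvPolynomial.map (algebraMap ℝ ℂ) f) =
      ((MvPolynomial.eval x f : ℝ) : ℂ) := by
  simpa using eval_map_ofReal_line f x 0 0

/-- Complex conjugation commutes with evaluating the complexification. [folklore] -/
theorem conj_eval_map (f : MvPolynomial σ ℝ) (g : σ → ℂ) :
    conj (MvPolynomial.eval g (MvPolynomial.map (algebraMap ℝ ℂ) f)) =
      MvPolynomial.eval (fun j => conj (g j)) (MvPolynomial.map (algebraMap ℝ ℂ) f) := by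
  rw [MvPolynomial.map_eval (starRingEnd ℂ) g, MvPolynomial.map_map]
  have : (starRingEnd ℂ).comp (algebraMap ℝ ℂ) = algebraMap ℝ ℂ :=
    RingHom.ext fun r => Complex.conj_ofReal r
  rw [this]
  rfl

/-- A conjugate of a complex zero of `z ↦ f(x + z b)` (real `x, b`) is again a zero. [folklore] -/
theorem eval_line_conj_eq_zero (f : MvPolynomial σ ℝ) (x b : σ → ℝ) {z : ℂ}
    (hz : MvPolynomial.eval (fun j => (x j : ℂ) + z * (b j : ℂ)) (MvPolynomial.map (algebraMap ℝ ℂ) f)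
      = 0) :
    MvPolynomial.eval (fun j => (x j : ℂ) + conj z * (b j : ℂ)) (MvPolynomial.map (algebraMap ℝ ℂ) f)
      = 0 := by
  have := congrArg conj hz
  rw [map_zero, conj_eval_map] at this
  simpa using this

end Complexify

/-! ### Gårding's theorem: hyperbolicity in every direction of the open cone -/

section Garding

open Polynomial Complex

/-- Gårding's auxiliary family of complex polynomials `τ ↦ f_ℂ(x + i e + τ b)`.
[cite: Garding1959, §2 (proof of Thm 2)] -/
def gardingPoly (f : MvPolynomial σ ℝ) (e b x : σ → ℝ) : ℂ[X] :=
  linePoly (MvPolynomial.map (algebraMap ℝ ℂ) f) (fun j => (x j : ℂ) + I * (e j : ℂ))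
    (fun j => (b j : ℂ))

/-- `gardingPoly` evaluates at `τ` to `f_ℂ(x + ie + τb)`. [folklore] -/
theorem eval_gardingPoly (f : MvPolynomial σ ℝ) (e b x : σ → ℝ) (τ : ℂ) :
    (gardingPoly f e b x).eval τ =
      MvPolynomial.eval (fun j => (x j : ℂ) + I * (e j : ℂ) + τ * (b j : ℂ))
        (MvPolynomial.map (algebraMap ℝ ℂ) f) := by
  rw [gardingPoly, eval_linePoly]
  refine congrArg (fun g : σ → ℂ => MvPolynomial.eval g _) (funext fun j => ?_)
  simp

variable {f : MvPolynomial σ ℝ} {d : ℕ} {e b : σ → ℝ}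

/-- The complexification does not vanish at a real vector where `f` does not. [folklore] -/
theorem eval_map_ofReal_ne_zero {x : σ → ℝ} (hx : MvPolynomial.eval x f ≠ 0) :
    MvPolynomial.eval (fun j => (x j : ℂ)) (MvPolynomial.map (algebraMap ℝ ℂ) f) ≠ 0 := by
  rw [eval_map_ofReal]; exact_mod_cast hx

/-- `gardingPoly` has degree `d`. [folklore] -/
theorem natDegree_gardingPoly (hf : f.IsHomogeneous d) (hb : MvPolynomial.eval b f ≠ 0)
    (x : σ → ℝ) : (gardingPoly f e b x).natDegree = d :=
  natDegree_linePoly (hf.map _) (eval_map_ofReal_ne_zero hb) _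

/-- The top coefficient of `gardingPoly` is `f(b)`. [folklore] -/
theorem coeff_gardingPoly_d (hf : f.IsHomogeneous d) (x : σ → ℝ) :
    (gardingPoly f e b x).coeff d = ((MvPolynomial.eval b f : ℝ) : ℂ) := by
  rw [gardingPoly, coeff_linePoly_eq_eval (hf.map _), eval_map_ofReal]

/-- `gardingPoly` is non-zero. [folklore] -/
theorem gardingPoly_ne_zero (hf : f.IsHomogeneous d) (hb : MvPolynomial.eval b f ≠ 0)
    (x : σ → ℝ) : gardingPoly f e b x ≠ 0 :=
  linePoly_ne_zero (hf.map _) (eval_map_ofReal_ne_zero hb) _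

/-- The coefficients of `gardingPoly` depend continuously on the base point. [folklore] -/
theorem continuous_coeff_gardingPoly (f : MvPolynomial σ ℝ) (e b : σ → ℝ) (k : ℕ) :
    Continuous fun x : σ → ℝ => (gardingPoly f e b x).coeff k := by
  have hc : Continuous fun x : σ → ℝ => fun j => (x j : ℂ) + I * (e j : ℂ) :=
    continuous_pi fun j => (continuous_ofReal.comp (continuous_apply j)).add continuous_const
  exact (continuous_coeff_linePoly (MvPolynomial.map (algebraMap ℝ ℂ) f) (fun j => (b j : ℂ)) k).comp hc

/-- Step 0 (hyperbolicity in direction `e`): `τ ↦ f_ℂ(x + ie + τb)` has no real roots.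
[cite: Garding1959, §2] -/
theorem gardingPoly_no_real_root (h : IsHyperbolic f e) (x : σ → ℝ) {τ : ℂ}
    (hτ : (gardingPoly f e b x).IsRoot τ) : τ.im ≠ 0 := by
  intro him
  have hτre : τ = (τ.re : ℂ) := Complex.ext (by simp) (by simp [him])
  rw [IsRoot.def, eval_gardingPoly, hτre] at hτ
  have key : MvPolynomial.eval (fun j => ((x + τ.re • b) j : ℂ) + I * (e j : ℂ))
      (MvPolynomial.map (algebraMap ℝ ℂ) f) = 0 := by
    rw [← hτ]
    refine congrArg (fun g : σ → ℂ => MvPolynomial.eval g _) (funext fun j => ?_)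
    simp only [Pi.add_apply, Pi.smul_apply, smul_eq_mul, ofReal_add, ofReal_mul]
    ring
  have := h.im_eq_zero (x + τ.re • b) key
  simp at this

/-- Step 1 (the base point `x = 0`): the roots of `τ ↦ f_ℂ(ie + τb)` are `-i/λⱼ(b)`, in the open
lower half-plane, when `b` lies in the open cone. [cite: Garding1959, §2] -/
theorem gardingPoly_zero_root_im_neg (hf : f.IsHomogeneous d) (h : IsHyperbolic f e)
    (hb : b ∈ openHyperbolicityCone f e) {τ : ℂ} (hτ : (gardingPoly f e b 0).IsRoot τ) :
    τ.im < 0 := by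
  rw [IsRoot.def, eval_gardingPoly] at hτ
  simp only [Pi.zero_apply, ofReal_zero, zero_add] at hτ
  -- `τ ≠ 0` since `f_ℂ(ie) = i^d f(e) ≠ 0`
  have hτ0 : τ ≠ 0 := by
    rintro rfl
    simp only [zero_mul, add_zero] at hτ
    have : MvPolynomial.eval (I • fun j => (e j : ℂ)) (MvPolynomial.map (algebraMap ℝ ℂ) f) = 0 := by
      rw [← hτ]
      exact congrArg (fun g : σ → ℂ => MvPolynomial.eval g _) (funext fun j => by simp)
    rw [(hf.map _).eval_smul_eq, eval_map_ofReal, mul_eq_zero] at this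
    rcases this with h1 | h1
    · exact absurd h1 (pow_ne_zero _ I_ne_zero)
    · exact h.eval_ne_zero (by exact_mod_cast h1)
  -- rescale: `f_ℂ(b + (i/τ) e) = 0`
  have key : MvPolynomial.eval (fun j => (b j : ℂ) + (I / τ) * (e j : ℂ))
      (MvPolynomial.map (algebraMap ℝ ℂ) f) = 0 := by
    have hsm : (fun j => I * (e j : ℂ) + τ * (b j : ℂ)) =
        τ • fun j => (b j : ℂ) + (I / τ) * (e j : ℂ) := by
      funext j
      have hτ' : τ * τ⁻¹ = 1 := mul_inv_cancel₀ hτ0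
      simp only [Pi.smul_apply, smul_eq_mul]
      linear_combination (-(I * (e j : ℂ))) * hτ'
    rw [hsm, (hf.map _).eval_smul_eq, mul_eq_zero] at hτ
    rcases hτ with h1 | h1
    · exact absurd h1 (pow_ne_zero _ hτ0)
    · exact h1
  have him : (I / τ).im = 0 := h.im_eq_zero b key
  set t : ℝ := (I / τ).re with ht
  have hIt : I / τ = (t : ℂ) := Complex.ext (by simp [ht]) (by simp [him])
  rw [hIt, eval_map_ofReal_line] at key
  have hreal : MvPolynomial.eval (b + t • e) f = 0 := by exact_mod_cast key
  have htneg : t < 0 := by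
    by_contra hge
    exact hb t (not_lt.1 hge) hreal
  have hτeq : τ = I / (t : ℂ) := by
    have ht0 : (t : ℂ) ≠ 0 := by exact_mod_cast htneg.ne
    rw [← hIt]; field_simp
  rw [hτeq, div_ofReal_im, I_im]
  exact div_neg_of_pos_of_neg one_pos htneg

/-- **Gårding's root location** (the heart of Gårding 1959, Thm 2): for `b` in the open cone
and every real `x`, all roots of `τ ↦ f_ℂ(x + ie + τb)` lie in the open lower half-plane. The set
of such `x` is clopen (roots move continuously and are never real) and contains `0`.
[cite: Garding1959, Thm 2] -/
theorem gardingPoly_root_im_neg (hf : f.IsHomogeneous d) (h : IsHyperbolic f e)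
    (hb : b ∈ openHyperbolicityCone f e) (x : σ → ℝ) {τ : ℂ}
    (hτ : (gardingPoly f e b x).IsRoot τ) : τ.im < 0 := by
  classical
  have hb0 : MvPolynomial.eval b f ≠ 0 := eval_ne_zero_of_mem_openHyperbolicityCone hb
  set A : Set (σ → ℝ) := {x | ∀ τ : ℂ, (gardingPoly f e b x).IsRoot τ → τ.im < 0} with hA
  -- data for the root lemmas, at a point `x₀`
  have hdeg : ∀ y : σ → ℝ, (gardingPoly f e b y).natDegree ≤ d := fun y =>
    (natDegree_gardingPoly hf hb0 y).le
  have hqd : ∀ y : σ → ℝ, (gardingPoly f e b y).coeff d ≠ 0 := fun y => by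
    rw [coeff_gardingPoly_d hf]; exact_mod_cast hb0
  have hlim : ∀ x₀ : σ → ℝ, ∀ k, Tendsto (fun y => (gardingPoly f e b y).coeff k) (𝓝 x₀)
      (𝓝 ((gardingPoly f e b x₀).coeff k)) := fun x₀ k =>
    (continuous_coeff_gardingPoly f e b k).tendsto x₀
  have hopen : IsOpen A := by
    refine isOpen_iff_mem_nhds.2 fun x₀ hx₀ => ?_
    -- a uniform gap below the real axis
    obtain ⟨ε, hε, hgap⟩ : ∃ ε : ℝ, 0 < ε ∧ ∀ τ₀ ∈ (gardingPoly f e b x₀).roots, τ₀.im < -ε := by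
      by_cases hne : (gardingPoly f e b x₀).roots.toFinset.Nonempty
      · obtain ⟨τ₁, hτ₁, hmax⟩ :=
          (gardingPoly f e b x₀).roots.toFinset.exists_max_image (fun τ => τ.im) hne
        have h1 : τ₁.im < 0 :=
          hx₀ τ₁ ((mem_roots (gardingPoly_ne_zero hf hb0 x₀)).1 (Multiset.mem_toFinset.1 hτ₁))
        refine ⟨-τ₁.im / 2, by linarith, fun τ₀ hτ₀ => ?_⟩
        have := hmax τ₀ (Multiset.mem_toFinset.2 hτ₀)
        linarith
      · exact ⟨1, one_pos, fun τ₀ hτ₀ => (hne ⟨τ₀, Multiset.mem_toFinset.2 hτ₀⟩).elim⟩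
    filter_upwards [eventually_roots_near hdeg (hdeg x₀) (hqd x₀) (hlim x₀) hε] with y hy τ hτ
    obtain ⟨τ₀, hτ₀, hnear⟩ := hy τ ((mem_roots (gardingPoly_ne_zero hf hb0 y)).2 hτ)
    have h1 := hgap τ₀ hτ₀
    have h2 : |(τ - τ₀).im| ≤ ‖τ - τ₀‖ := abs_im_le_norm _
    rw [sub_im] at h2
    have h3 := (abs_le.1 h2).2
    linarith
  have hclosed : IsClosed A := by
    rw [← isOpen_compl_iff]
    refine isOpen_iff_mem_nhds.2 fun x₀ hx₀ => ?_
    rw [hA, Set.mem_compl_iff, Set.mem_setOf_eq] at hx₀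
    push Not at hx₀
    obtain ⟨τ₀, hτ₀, him⟩ := hx₀
    have hpos : 0 < τ₀.im := lt_of_le_of_ne him (gardingPoly_no_real_root h x₀ hτ₀).symm
    filter_upwards [eventually_exists_root_near hdeg (hdeg x₀) (hqd x₀) (hlim x₀) hτ₀
      (half_pos hpos)] with y hy
    obtain ⟨τ, hτ, hnear⟩ := hy
    rw [Set.mem_compl_iff, hA, Set.mem_setOf_eq]
    push Not
    have hne : gardingPoly f e b y ≠ 0 := gardingPoly_ne_zero hf hb0 y
    refine ⟨τ, (mem_roots hne).1 hτ, ?_⟩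
    have h2 : |(τ - τ₀).im| ≤ ‖τ - τ₀‖ := abs_im_le_norm _
    rw [sub_im] at h2
    have h3 := (abs_le.1 h2).1
    linarith
  have hne : A.Nonempty := ⟨0, fun τ hτ => gardingPoly_zero_root_im_neg hf h hb hτ⟩
  have hA' : A = Set.univ := IsClopen.eq_univ ⟨hclosed, hopen⟩ hne
  have hx : x ∈ A := by rw [hA']; trivial
  exact hx τ hτ

/-- **Gårding's theorem, first half**: a form hyperbolic w.r.t. `e` is hyperbolic w.r.t. every point
of the open cone `Λ₊₊(f, e)` (Gårding 1959, Thm 2; Renegar 2006, Thm 3). Proof: for `s > 0` all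
roots of `τ ↦ f_ℂ(x + ise + τb)` lie in the lower half-plane (rescale `gardingPoly_root_im_neg`);
letting `s → 0⁺` the roots of `τ ↦ f_ℂ(x + τb)` have `Im ≤ 0`, and by conjugation symmetry
`Im = 0`. [cite: Garding1959, Thm 2] -/
theorem IsHyperbolic.of_mem_openHyperbolicityCone (hf : f.IsHomogeneous d) (h : IsHyperbolic f e)
    (hb : b ∈ openHyperbolicityCone f e) : IsHyperbolic f b := by
  classical
  have hb0 : MvPolynomial.eval b f ≠ 0 := eval_ne_zero_of_mem_openHyperbolicityCone hb
  -- the family `s ↦ (τ ↦ f_ℂ(x + ise + τb)) = gardingPoly f (s • e) b x` and its limit at `s = 0`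
  have main : ∀ (x : σ → ℝ) (z : ℂ),
      MvPolynomial.eval (fun j => (x j : ℂ) + z * (b j : ℂ)) (MvPolynomial.map (algebraMap ℝ ℂ) f)
        = 0 → z.im ≤ 0 := by
    intro x z hz
    have hProot : ∀ s : ℝ, 0 < s → ∀ τ : ℂ, (gardingPoly f (s • e) b x).IsRoot τ → τ.im < 0 := by
      intro s hs τ hτ
      have hs0 : (s : ℂ) ≠ 0 := by exact_mod_cast hs.ne'
      rw [IsRoot.def, eval_gardingPoly] at hτ
      -- rescale by `s`: the point is `s • ((x/s) + i e + (τ/s) b)`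
      have key : (gardingPoly f e b (s⁻¹ • x)).IsRoot (τ / s) := by
        rw [IsRoot.def, eval_gardingPoly]
        have hsm : (fun j => (x j : ℂ) + I * (((s • e) j : ℝ) : ℂ) + τ * (b j : ℂ)) =
            (s : ℂ) • fun j => (((s⁻¹ • x) j : ℝ) : ℂ) + I * (e j : ℂ) + τ / s * (b j : ℂ) := by
          funext j
          have hs' : (s : ℂ) * (s : ℂ)⁻¹ = 1 := mul_inv_cancel₀ hs0
          simp only [Pi.smul_apply, smul_eq_mul, ofReal_mul, ofReal_inv]
          linear_combination (-((x j : ℂ)) - τ * (b j : ℂ)) * hs'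
        rw [hsm, (hf.map _).eval_smul_eq, mul_eq_zero] at hτ
        rcases hτ with h1 | h1
        · exact absurd h1 (pow_ne_zero _ hs0)
        · exact h1
      have := gardingPoly_root_im_neg hf h hb (s⁻¹ • x) key
      rw [div_ofReal_im] at this
      by_contra hge
      exact absurd this (not_lt.2 (div_nonneg (not_lt.1 hge) hs.le))
    have hdeg : ∀ s : ℝ, (gardingPoly f (s • e) b x).natDegree ≤ d := fun s =>
      (natDegree_gardingPoly hf hb0 x).le
    have hcoeffd : ∀ s : ℝ, (gardingPoly f (s • e) b x).coeff d = ((MvPolynomial.eval b f : ℝ) : ℂ) :=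
      fun s => coeff_gardingPoly_d hf x
    have hlim : ∀ k, Tendsto (fun s : ℝ => (gardingPoly f (s • e) b x).coeff k) (𝓝[>] 0)
        (𝓝 ((gardingPoly f ((0 : ℝ) • e) b x).coeff k)) := by
      intro k
      have hX : Continuous fun s : ℝ => fun j => (x j : ℂ) + I * (((s • e) j : ℝ) : ℂ) := by
        refine continuous_pi fun j => ?_
        simp only [Pi.smul_apply, smul_eq_mul, ofReal_mul]
        exact continuous_const.add (continuous_const.mul
          ((continuous_ofReal.comp continuous_id).mul continuous_const))
      exact (((continuous_coeff_linePoly (MvPolynomial.map (algebraMap ℝ ℂ) f)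
        (fun j => (b j : ℂ)) k).comp hX).tendsto 0).mono_left nhdsWithin_le_nhds
    have hz' : (gardingPoly f ((0 : ℝ) • e) b x).IsRoot z := by
      rw [IsRoot.def, eval_gardingPoly, ← hz]
      refine congrArg (fun g : σ → ℂ => MvPolynomial.eval g _) (funext fun j => ?_)
      simp
    by_contra hpos
    push Not at hpos
    have hev := eventually_exists_root_near hdeg (hdeg 0) (by rw [hcoeffd]; exact_mod_cast hb0)
      hlim hz' (half_pos hpos)
    obtain ⟨s, ⟨τ, hτ, hnear⟩, hs⟩ := (hev.and self_mem_nhdsWithin).exists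
    have hne : gardingPoly f (s • e) b x ≠ 0 := gardingPoly_ne_zero hf hb0 x
    have h1 := hProot s hs τ ((mem_roots hne).1 hτ)
    have h2 : |(τ - z).im| ≤ ‖τ - z‖ := abs_im_le_norm _
    rw [sub_im] at h2
    have h3 := (abs_le.1 h2).1
    linarith
  refine ⟨hb0, fun x z hz => le_antisymm (main x z hz) ?_⟩
  have := main x (conj z) (eval_line_conj_eq_zero f x b hz)
  rw [conj_im] at this
  linarith

end Garding

/-! ### Consequences: independence of the direction, convexity, the boundary -/

section Cones

open Polynomial Complex

variable {f : MvPolynomial σ ℝ} {d : ℕ} {e b : σ → ℝ}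

/-- The complexified line polynomial `τ ↦ f_ℂ(x + τ b)` (real `x`, `b`). [folklore] -/
def cLinePoly (f : MvPolynomial σ ℝ) (x b : σ → ℝ) : ℂ[X] :=
  linePoly (MvPolynomial.map (algebraMap ℝ ℂ) f) (fun j => (x j : ℂ)) (fun j => (b j : ℂ))

/-- `cLinePoly` evaluates at `τ` to `f_ℂ(x + τb)`. [folklore] -/
theorem eval_cLinePoly (f : MvPolynomial σ ℝ) (x b : σ → ℝ) (τ : ℂ) :
    (cLinePoly f x b).eval τ =
      MvPolynomial.eval (fun j => (x j : ℂ) + τ * (b j : ℂ)) (MvPolynomial.map (algebraMap ℝ ℂ) f) := by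
  rw [cLinePoly, eval_linePoly]
  refine congrArg (fun g : σ → ℂ => MvPolynomial.eval g _) (funext fun j => ?_)
  simp

/-- A real zero `t` of `t ↦ f(x + tb)` is a root of the complexified line polynomial. [folklore] -/
theorem isRoot_cLinePoly_ofReal {x : σ → ℝ} {t : ℝ} (ht : MvPolynomial.eval (x + t • b) f = 0) :
    (cLinePoly f x b).IsRoot (t : ℂ) := by
  rw [IsRoot.def, eval_cLinePoly, eval_map_ofReal_line, ht, ofReal_zero]

/-- For `f` hyperbolic w.r.t. `b`, a complex root of `τ ↦ f_ℂ(x + τb)` is real, and a real zero of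
`t ↦ f(x + tb)`. [cite: Renegar2006, §2] -/
theorem IsHyperbolic.root_cLinePoly (h : IsHyperbolic f b) {x : σ → ℝ} {τ : ℂ}
    (hτ : (cLinePoly f x b).IsRoot τ) : τ = (τ.re : ℂ) ∧ MvPolynomial.eval (x + τ.re • b) f = 0 := by
  rw [IsRoot.def, eval_cLinePoly] at hτ
  have him : τ.im = 0 := h.im_eq_zero x hτ
  have hre : τ = (τ.re : ℂ) := Complex.ext (by simp) (by simp [him])
  refine ⟨hre, ?_⟩
  rw [hre, eval_map_ofReal_line] at hτ
  exact_mod_cast hτ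

/-- `cLinePoly` has degree `d`. [folklore] -/
theorem natDegree_cLinePoly (hf : f.IsHomogeneous d) (hb : MvPolynomial.eval b f ≠ 0) (x : σ → ℝ) :
    (cLinePoly f x b).natDegree = d :=
  natDegree_linePoly (hf.map _) (eval_map_ofReal_ne_zero hb) _

/-- The top coefficient of `cLinePoly` is `f(b)`. [folklore] -/
theorem coeff_cLinePoly_d (hf : f.IsHomogeneous d) (x : σ → ℝ) :
    (cLinePoly f x b).coeff d = ((MvPolynomial.eval b f : ℝ) : ℂ) := by
  rw [cLinePoly, coeff_linePoly_eq_eval (hf.map _), eval_map_ofReal]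

/-- `cLinePoly` is non-zero. [folklore] -/
theorem cLinePoly_ne_zero (hf : f.IsHomogeneous d) (hb : MvPolynomial.eval b f ≠ 0) (x : σ → ℝ) :
    cLinePoly f x b ≠ 0 :=
  linePoly_ne_zero (hf.map _) (eval_map_ofReal_ne_zero hb) _

/-- The coefficients of `cLinePoly` depend continuously on the base point. [folklore] -/
theorem continuous_coeff_cLinePoly (f : MvPolynomial σ ℝ) (b : σ → ℝ) (k : ℕ) :
    Continuous fun x : σ → ℝ => (cLinePoly f x b).coeff k := by
  have hc : Continuous fun x : σ → ℝ => fun j => (x j : ℂ) :=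
    continuous_pi fun j => continuous_ofReal.comp (continuous_apply j)
  exact (continuous_coeff_linePoly (MvPolynomial.map (algebraMap ℝ ℂ) f) (fun j => (b j : ℂ)) k).comp hc

/-- If `b ∈ Λ₊₊(f, e)` then `e ∈ Λ₊₊(f, b)` (the roots of `t ↦ f(e + tb)` are the `-1/λⱼ(b) < 0`).
[cite: Garding1959, §2] -/
theorem mem_openHyperbolicityCone_comm (hf : f.IsHomogeneous d) (he : MvPolynomial.eval e f ≠ 0)
    (hb : b ∈ openHyperbolicityCone f e) : e ∈ openHyperbolicityCone f b := by
  intro t ht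
  rcases ht.eq_or_lt with rfl | ht'
  · simpa using he
  · have : e + t • b = t • (b + t⁻¹ • e) := by
      rw [smul_add, smul_smul, mul_inv_cancel₀ ht'.ne', one_smul, add_comm]
    rw [this, hf.eval_smul_eq]
    exact mul_ne_zero (pow_ne_zero _ ht'.ne') (hb _ (inv_nonneg.2 ht))

/-- The open cone of a hyperbolic form is open (the roots of `t ↦ f(x + tb)`, all real and
negative, stay negative nearby). [cite: Renegar2006, §2] -/
theorem IsHyperbolic.isOpen_openHyperbolicityCone (hf : f.IsHomogeneous d) (h : IsHyperbolic f b) :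
    IsOpen (openHyperbolicityCone f b) := by
  refine isOpen_iff_mem_nhds.2 fun x₀ hx₀ => ?_
  have hb0 := h.eval_ne_zero
  have hroots : ∀ τ₀ ∈ (cLinePoly f x₀ b).roots, τ₀ ∈ {τ : ℂ | τ.re < 0} := by
    intro τ₀ hτ₀
    obtain ⟨hre, hev⟩ := h.root_cLinePoly ((mem_roots (cLinePoly_ne_zero hf hb0 x₀)).1 hτ₀)
    exact (mem_openHyperbolicityCone_iff_forall_root_neg f b x₀).1 hx₀ _ hev
  have hev := eventually_roots_subset_of_isOpen (l := 𝓝 x₀) (p := fun y => cLinePoly f y b)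
    (fun y => (natDegree_cLinePoly hf hb0 y).le) (natDegree_cLinePoly hf hb0 x₀).le
    (by rw [coeff_cLinePoly_d hf]; exact_mod_cast hb0)
    (fun k => (continuous_coeff_cLinePoly f b k).tendsto x₀) (isOpen_lt continuous_re continuous_const)
    hroots
  filter_upwards [hev] with y hy
  refine (mem_openHyperbolicityCone_iff_forall_root_neg f b y).2 fun t ht => ?_
  have := hy (t : ℂ) ((mem_roots (cLinePoly_ne_zero hf hb0 y)).2 (isRoot_cLinePoly_ofReal ht))
  simpa using this

/-- The open cone is star-shaped about its direction. [cite: Garding1959, §2] -/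
theorem starConvex_openHyperbolicityCone (hf : f.IsHomogeneous d) (he : MvPolynomial.eval e f ≠ 0) :
    StarConvex ℝ e (openHyperbolicityCone f e) := by
  intro y hy a c ha hc hac
  rcases hc.eq_or_lt with rfl | hc'
  · rw [add_zero] at hac
    rw [hac, one_smul, zero_smul, add_zero]
    exact self_mem_openHyperbolicityCone hf he
  · have hy' : y + (a / c) • e ∈ openHyperbolicityCone f e := by
      rcases ha.eq_or_lt with rfl | ha'
      · simpa using hy
      · exact add_smul_mem_openHyperbolicityCone (openHyperbolicityCone_subset f e hy)
          (div_pos ha' hc')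
    have : a • e + c • y = c • (y + (a / c) • e) := by
      rw [smul_add, smul_smul, mul_div_cancel₀ _ hc'.ne', add_comm]
    rw [this]
    exact smul_mem_openHyperbolicityCone hf hy' hc'

/-- Key step for the independence of the direction: if `f` is hyperbolic w.r.t. both `e` and `b`
and `b ∈ Λ₊₊(f,e)`, then `Λ₊₊(f,e) ⊆ Λ₊₊(f,b)`. The open cone of `e` is connected (star-shaped)
and splits into the open set `Λ₊₊(f,b)` and the open set of points `x` for which `t ↦ f(x + tb)`
has a positive root; the first part contains `b`. [cite: Garding1959, Thm 2] -/
theorem openHyperbolicityCone_subset_of_mem (hf : f.IsHomogeneous d) (he : IsHyperbolic f e)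
    (hbh : IsHyperbolic f b) (hb : b ∈ openHyperbolicityCone f e) :
    openHyperbolicityCone f e ⊆ openHyperbolicityCone f b := by
  have hb0 := hbh.eval_ne_zero
  set v : Set (σ → ℝ) := {x | ∃ t : ℝ, 0 < t ∧ MvPolynomial.eval (x + t • b) f = 0} with hv
  have hvopen : IsOpen v := by
    refine isOpen_iff_mem_nhds.2 fun x₀ hx₀ => ?_
    obtain ⟨t₀, ht₀, hev₀⟩ := hx₀
    have hev := eventually_exists_root_near (l := 𝓝 x₀) (p := fun y => cLinePoly f y b)
      (fun y => (natDegree_cLinePoly hf hb0 y).le) (natDegree_cLinePoly hf hb0 x₀).le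
      (by rw [coeff_cLinePoly_d hf]; exact_mod_cast hb0)
      (fun k => (continuous_coeff_cLinePoly f b k).tendsto x₀) (isRoot_cLinePoly_ofReal hev₀)
      (half_pos ht₀)
    filter_upwards [hev] with y hy
    obtain ⟨τ, hτ, hnear⟩ := hy
    obtain ⟨hre, hev⟩ := hbh.root_cLinePoly ((mem_roots (cLinePoly_ne_zero hf hb0 y)).1 hτ)
    refine ⟨τ.re, ?_, hev⟩
    have h2 : |(τ - (t₀ : ℂ)).re| ≤ ‖τ - (t₀ : ℂ)‖ := abs_re_le_norm _
    rw [sub_re, ofReal_re] at h2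
    have h3 := (abs_le.1 h2).1
    linarith
  have hdisj : Disjoint (openHyperbolicityCone f b) v := by
    refine Set.disjoint_left.2 fun x hx hxv => ?_
    obtain ⟨t, ht, hev⟩ := hxv
    exact hx t ht.le hev
  have hcover : openHyperbolicityCone f e ⊆ openHyperbolicityCone f b ∪ v := by
    intro x hx
    by_cases hxv : ∃ t : ℝ, 0 < t ∧ MvPolynomial.eval (x + t • b) f = 0
    · exact Or.inr hxv
    · refine Or.inl fun t ht hev => ?_
      rcases ht.eq_or_lt with rfl | ht'
      · exact eval_ne_zero_of_mem_openHyperbolicityCone hx (by simpa using hev)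
      · exact hxv ⟨t, ht', hev⟩
  have hne : (openHyperbolicityCone f e ∩ openHyperbolicityCone f b).Nonempty :=
    ⟨b, hb, self_mem_openHyperbolicityCone hf hb0⟩
  have hconn : IsPreconnected (openHyperbolicityCone f e) :=
    ((starConvex_openHyperbolicityCone hf he.eval_ne_zero).isPathConnected
      (self_mem_openHyperbolicityCone hf he.eval_ne_zero)).isConnected.isPreconnected
  exact hconn.subset_left_of_subset_union (hbh.isOpen_openHyperbolicityCone hf) hvopen hdisj hcover
    hne

/-- **Gårding's theorem, second half**: the open cone does not depend on the choice of the direction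
inside it (Gårding 1959, Thm 2: `C(b) = C(a)` for `b ∈ C(a)`; Renegar 2006, Thm 3).
[cite: Garding1959, Thm 2] -/
theorem openHyperbolicityCone_eq_of_mem (hf : f.IsHomogeneous d) (he : IsHyperbolic f e)
    (hb : b ∈ openHyperbolicityCone f e) : openHyperbolicityCone f b = openHyperbolicityCone f e :=
  have hbh := he.of_mem_openHyperbolicityCone hf hb
  Set.Subset.antisymm
    (openHyperbolicityCone_subset_of_mem hf hbh he (mem_openHyperbolicityCone_comm hf he.1 hb))
    (openHyperbolicityCone_subset_of_mem hf he hbh hb)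

/-- `Λ₊` is the closure of `Λ₊₊` (Renegar 2006, §2). [cite: Renegar2006, §2] -/
theorem hyperbolicityCone_eq_closure (hf : f.IsHomogeneous d) (he : IsHyperbolic f e) :
    hyperbolicityCone f e = closure (openHyperbolicityCone f e) := by
  refine Set.Subset.antisymm (fun x hx => ?_)
    (closure_minimal (openHyperbolicityCone_subset f e) (isClosed_hyperbolicityCone hf he))
  have ht : Tendsto (fun s : ℝ => x + s • e) (𝓝[>] 0) (𝓝 x) := by
    have : Continuous fun s : ℝ => x + s • e := continuous_const.add (continuous_id.smul continuous_const)
    simpa using (this.tendsto 0).mono_left nhdsWithin_le_nhds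
  refine mem_closure_of_tendsto ht ?_
  filter_upwards [self_mem_nhdsWithin] with s hs
  exact add_smul_mem_openHyperbolicityCone hx hs

/-- The closed cone does not depend on the direction either. [cite: Garding1959, Thm 2] -/
theorem hyperbolicityCone_eq_of_mem (hf : f.IsHomogeneous d) (he : IsHyperbolic f e)
    (hb : b ∈ openHyperbolicityCone f e) : hyperbolicityCone f b = hyperbolicityCone f e := by
  rw [hyperbolicityCone_eq_closure hf he,
    hyperbolicityCone_eq_closure hf (he.of_mem_openHyperbolicityCone hf hb),
    openHyperbolicityCone_eq_of_mem hf he hb]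

/-- `Λ₊₊` is closed under addition. [cite: Garding1959, Thm 2] -/
theorem add_mem_openHyperbolicityCone (hf : f.IsHomogeneous d) (he : IsHyperbolic f e)
    {x y : σ → ℝ} (hx : x ∈ openHyperbolicityCone f e) (hy : y ∈ openHyperbolicityCone f e) :
    x + y ∈ openHyperbolicityCone f e := by
  rw [← openHyperbolicityCone_eq_of_mem hf he hx] at hy ⊢
  intro t ht
  have := hy (1 + t) (by positivity)
  rwa [add_smul, one_smul, ← add_assoc, add_comm y x] at this

/-- **Gårding's theorem: the open hyperbolicity cone is convex** (Gårding 1959, Thm 2; Renegar 2006,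
Thm 3). [cite: Garding1959, Thm 2] -/
theorem convex_openHyperbolicityCone (hf : f.IsHomogeneous d) (he : IsHyperbolic f e) :
    Convex ℝ (openHyperbolicityCone f e) := by
  intro x hx y hy a c ha hc hac
  rcases ha.eq_or_lt with rfl | ha'
  · rw [zero_add] at hac
    simpa [hac] using hy
  rcases hc.eq_or_lt with rfl | hc'
  · rw [add_zero] at hac
    simpa [hac] using hx
  exact add_mem_openHyperbolicityCone hf he (smul_mem_openHyperbolicityCone hf hx ha')
    (smul_mem_openHyperbolicityCone hf hy hc')

/-- **The closed hyperbolicity cone is convex.** [cite: Garding1959, Thm 2] -/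
theorem convex_hyperbolicityCone (hf : f.IsHomogeneous d) (he : IsHyperbolic f e) :
    Convex ℝ (hyperbolicityCone f e) := by
  rw [hyperbolicityCone_eq_closure hf he]
  exact (convex_openHyperbolicityCone hf he).closure

/-- The interior of `Λ₊` is `Λ₊₊`. [cite: Renegar2006, §2] -/
theorem interior_hyperbolicityCone (hf : f.IsHomogeneous d) (he : IsHyperbolic f e) :
    interior (hyperbolicityCone f e) = openHyperbolicityCone f e := by
  refine Set.Subset.antisymm (fun x hx => ?_)
    ((he.isOpen_openHyperbolicityCone hf).subset_interior_iff.2 (openHyperbolicityCone_subset f e))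
  rw [mem_interior_iff_mem_nhds] at hx
  have ht : Tendsto (fun s : ℝ => x - s • e) (𝓝[>] 0) (𝓝 x) := by
    have : Continuous fun s : ℝ => x - s • e := continuous_const.sub (continuous_id.smul continuous_const)
    simpa using (this.tendsto 0).mono_left nhdsWithin_le_nhds
  obtain ⟨s, hs, hspos⟩ := ((ht.eventually hx).and self_mem_nhdsWithin).exists
  have := add_smul_mem_openHyperbolicityCone hs (Set.mem_Ioi.1 hspos)
  rwa [sub_add_cancel] at this

/-- The boundary of `Λ₊` consists of its points where `f` vanishes (`λ_min = 0`).
[cite: Renegar2006, §2] -/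
theorem frontier_hyperbolicityCone (hf : f.IsHomogeneous d) (he : IsHyperbolic f e) :
    frontier (hyperbolicityCone f e) = {x ∈ hyperbolicityCone f e | MvPolynomial.eval x f = 0} := by
  rw [(isClosed_hyperbolicityCone hf he).frontier_eq, interior_hyperbolicityCone hf he]
  ext x
  simp only [Set.mem_sdiff, Set.mem_setOf_eq, mem_openHyperbolicityCone_iff, not_forall, not_not,
    exists_prop]
  constructor
  · rintro ⟨hx, t, ht, hev⟩
    refine ⟨hx, ?_⟩
    rcases ht.eq_or_lt with rfl | ht'
    · simpa using hev
    · exact absurd hev (hx t ht')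
  · rintro ⟨hx, hev⟩
    exact ⟨hx, 0, le_rfl, by simpa using hev⟩

/-- On the boundary, `f` vanishes; in the open cone it does not. Points of `Λ₊` with `f ≠ 0` are
interior. [cite: Renegar2006, §2] -/
theorem mem_openHyperbolicityCone_of_eval_ne_zero {x : σ → ℝ} (hx : x ∈ hyperbolicityCone f e)
    (hx0 : MvPolynomial.eval x f ≠ 0) : x ∈ openHyperbolicityCone f e := by
  intro t ht
  rcases ht.eq_or_lt with rfl | ht'
  · simpa using hx0
  · exact hx t ht'

end Cones

end Literature.AlgebraicGeometry.HyperbolicPolynomials
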